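import Summits.Ventures.PercRepro.S2ThirteenSevenSpreadThree
import Summits.Ventures.PercRepro.S2FourTriangleTop

/-!
# PercRepro — S2: THE ROWS `4 ≤ t ≤ 8` OF THE SPREAD CASE OF THE CELL `(13, 7)` MODULO THE SPREAD CAPS `s₄ ≤ 41`, `s₅ ≤ 146`
(p7, gen 17)

On a coloop-free spread `e`-free core of rank `13` on `20` points with `4 ≤ t ≤ 8` triangles, the four-triangle count
`U₅ ≤ 13398` (`S2.ncard_top_five_le_of_four_triangles`), the plain top-`6` charge
`U₆ ≤ 680·t + 120·s₄ + 15·s₅ + s₆ ≤ 680·8 + 120·41 + 15·146 + 924 = 13474` and `5·U ≤ 5·U₅ + 7·U₆` give `U ≤ 32261`; the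
three-triangle spanning Bonferroni gives `S ≤ 98941`; the tail at `t ≤ 8` with the caps `(41, 146)` gives `m = 148` and the
need `(1024 − 148)·4·9480/1024 = 32441.25` (ratio `0.9945` at `t = 8`, `0.903` at `t = 5`).
**`c025_thirteen_seven_cf_spread_le_eight_of_caps`**: the rows `4 ≤ t ≤ 8` modulo `s₄ ≤ 41` (p1 g33's spread chain, in the
tree) and `s₅ ≤ 146` (p1 g33's `S1.ncard_fiveCircuits_le_one_forty_six_thirteen_seven_of_tPoorSix`, modulo the plane-poor
`8`-spread table). Nothing about any cell is claimed. Axioms: standard.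
-/

open scoped Matroid

namespace PercRepro

namespace ThmN

open Set

variable {α : Type}

/-- **The rows `4 ≤ t ≤ 8` of the spread case of the coloop-free cell `(13, 7)` modulo the spread caps `s₄ ≤ 41`, `s₅ ≤ 146`.** -/
theorem c025_thirteen_seven_cf_spread_le_eight_of_caps (M : Matroid α) [M.Finite]
    (hR : M.eRank = ((13 : ℕ) : ℕ∞)) (hn : M.E.ncard = 13 + 7)
    (hfree : ∀ e ∈ M.E, ∃ A ⊆ M.E \ {e}, e ∉ M.closure A ∧ e ∉ M.closure ((M.E \ {e}) \ A))
    (h4 : ¬ ∃ W ⊆ M.E, W.ncard ≤ 9 ∧ W.encard = M.eRk W + 4)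
    (hs4c : {C : Set α | M.IsCircuit C ∧ C.ncard = 4}.ncard ≤ 41)
    (hs5c : {C : Set α | M.IsCircuit C ∧ C.ncard = 5}.ncard ≤ 146)
    (ht4 : 4 ≤ {C : Set α | M.IsCircuit C ∧ C.ncard = 3}.ncard)
    (ht8 : {C : Set α | M.IsCircuit C ∧ C.ncard = 3}.ncard ≤ 8) : RLS M 13 5 := by
  classical
  have hd : M.E.encard = M.eRank + ((7 : ℕ) : ℕ∞) := by
    rw [hR, ← M.ground_finite.cast_ncard_eq, hn]
    push_cast
    ring
  have hflat : ∀ X ⊆ M.E, M.eRk X ≤ 5 → X.ncard ≤ 8 := fun X hX hr => by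
    have := S2.ncard_le_of_eRk_le_of_not_nullity M 4 9 (by norm_num) h4 hX (r := 5) (by norm_num) (by exact_mod_cast hr)
    omega
  have hflat' : ∀ X ⊆ M.E, M.eRk X ≤ 4 → X.ncard ≤ 7 := fun X hX hr => by
    have := S2.ncard_le_of_eRk_le_of_not_nullity M 4 9 (by norm_num) h4 hX (r := 4) (by norm_num) (by exact_mod_cast hr)
    omega
  have hL0 : ∀ e ∈ M.E, ¬ M.IsLoop e := not_isLoop_of_free M hfree
  have hs : ∀ e ∈ M.E, ∀ f ∈ M.E, e ≠ f → M.eRk {e, f} = 2 := by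
    intro e he f hf hef
    have h2 : (2 : ℕ∞) ≤ M.eRk {e, f} :=
      two_le_eRk_of_two_le_ncard_of_free M hfree (pair_subset he hf) (by rw [ncard_pair hef])
    have h3 : M.eRk {e, f} ≤ 2 := by
      have := M.eRk_le_encard {e, f}
      rwa [encard_pair hef] at this
    exact le_antisymm h3 h2
  have hC1 : ∀ L ⊆ M.E, M.eRk L = 2 → L.ncard ≤ 3 :=
    fun L hL hr => ncard_le_three_of_eRk_two M hs hfree hL hr
  have hcirc : ∀ C, M.IsCircuit C → 3 ≤ C.encard := three_le_encard_of_circuit M hL0 hs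
  have hTfin : {C : Set α | M.IsCircuit C ∧ C.ncard = 3}.Finite :=
    M.ground_finite.finite_subsets.subset (fun C hC => hC.1.subset_ground)
  have hs6 : {C : Set α | M.IsCircuit C ∧ C.ncard = 6}.ncard ≤ (7 + 5).choose 6 :=
    Matroid.ncard_circuits_le_choose_of_encard M hd 5
  norm_num [Nat.choose] at hs6
  have hEfin := M.ground_finite
  have cellA : ∀ (U S m : ℕ) (A : ℚ), Matroid.topCount M 13 5 ≤ U →
      {X : Set α | X ⊆ M.E ∧ M.eRk X = M.eRank}.ncard ≤ S → m ≤ 1024 →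
      1024 * (U : ℚ) ≤ ((1024 - m : ℕ) : ℚ) * 2 ^ (7 - 5) * (9480 : ℚ) →
      (1024 : ℚ) * (A + (S : ℚ)) ≤ (m : ℚ) * 2 ^ 20 →
      ({X : Set α | X ⊆ M.E ∧ M.eRk X ≤ 5}.ncard : ℚ) ≤ A → RLS M 13 5 := by
    intro U S m A hU hS hm hpoly htail hA
    rw [RLS_iff]
    exact c025_core_five_cell_of_counts_xqictq5g M 13 7 (by norm_num) hR hn U hU _ hA S hS
      9480 (by norm_num) (phiK 13 5) (by rw [phiK_thirteen_five]; norm_num) ⟨m, hm, hpoly, htail⟩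
  -- the top count through the top `5`- and `6`-sets; the top `6`-sets by their smallest circuit, plain charge `680`
  have hUsum := S2.topCount_mul_five_le_seven M hR hd hC1 hflat
  have htop6 : {B : Set α | B ⊆ M.E ∧ B.ncard = 6 ∧ M.eRk B = 5 ∧ M.eRk (M.E \ B) = M.eRank}.ncard ≤ 13474 := by
    have hc680 : ∀ T : Set α, M.IsCircuit T → T.ncard = 3 →
        {B : Set α | B ⊆ M.E ∧ B.ncard = 6 ∧ T ⊆ B ∧ M.eRk (M.E \ B) = M.eRank}.ncard ≤ 680 := by
      intro T hT hT3
      have hsub : {B : Set α | B ⊆ M.E ∧ B.ncard = 6 ∧ T ⊆ B ∧ M.eRk (M.E \ B) = M.eRank} ⊆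
          {X : Set α | X ⊆ M.E ∧ X.ncard = 6 ∧ T ⊆ X} := fun B hB => ⟨hB.1, hB.2.1, hB.2.2.1⟩
      have h := (Set.ncard_le_ncard hsub (hEfin.finite_subsets.subset (fun X hX => hX.1))).trans
        (S2.ncard_subsets_superset_le M hT.subset_ground 6)
      rw [hn, hT3] at h
      norm_num [Nat.choose] at h
      exact h
    have := S2.ncard_top_six_le_n M hn hcirc 680 hc680
    norm_num [Nat.choose] at this
    have h3' := Nat.mul_le_mul_right 680 ht8
    have h5' := Nat.mul_le_mul_right 15 hs5c
    have h4' := Nat.mul_le_mul_right 120 hs4c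
    omega
  -- the tail at `t ≤ 8` with the caps `(41, 146)`
  have hA := ncard_eRk_le_five_le_spread M 13 7 (by norm_num) hR hn hfree hflat hflat' 8 41 146 ht8 hs4c hs5c
  -- four triangles: the top `5`-sets
  obtain ⟨T₁, T₂, T₃, T₄, hT₁, hT₂, hT₃, hT₄, h12, h13, h14, h23, h24, h34⟩ :=
    (Set.three_lt_ncard_iff hTfin).1 (by omega)
  have hS' : {X : Set α | X ⊆ M.E ∧ M.eRk X = M.eRank}.ncard ≤ 98941 := by
    have hS := S2.ncard_spanning_add_le_of_three_triangles M hR hn (by norm_num) hC1 hT₁.1 hT₁.2 hT₂.1 hT₂.2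
      hT₃.1 hT₃.2 h12 h13 h23
    norm_num [Finset.sum_range_succ, Nat.choose] at hS
    omega
  have htop5 := S2.ncard_top_five_le_of_four_triangles M hR hn hC1 hT₁ hT₂ hT₃ hT₄ h12 h13 h14 h23 h24 h34
  have hU' : Matroid.topCount M 13 5 ≤ 32261 := by omega
  exact cellA _ 98941 148 _ hU' hS' (by norm_num) (by norm_num) (by norm_num [Nat.choose]) hA

end ThmN

end PercRepro
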